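import Summits.RiemannHypothesis.RiemannHypothesis.Theorems.Splittings.RobinFiniteHeightLaw
import Literature.NumberTheory.LFunctions.ZeroDensityInghamHuxley
import HarnessLib

/-!
# RobinFiniteDensityTail — gen 12 ZERO-DENSITY LAYER, part 1/4 (D1–D2): the RH-free density tail and the FKS-row fold

Cell rh-split, seat rh-split-robin-finite g12 (card `cards/SPLIT-robin-finite.md` §19).  The tree's c = 1 height law
(`RobinFiniteHeightLaw`, gen 9) pays the unverified zeros `|γ| > T` at the tail-only price `√x·tailH(T)`; parts 1–4 add ONE
explicit zero-density row in print — Fiori–Kadiri–Swidinsky 2023 (J. Math. Anal. Appl. 527, 127426; arXiv:2204.02588) Cor. 2.9,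
Table 2 row `σ ∈ [0.9, 1]`: `N(0.9, T) ≤ 17.4194·T^{4/15}·(log T)^{16/5} + 2.9089·log² T` for `T ≥ H₀ = 3·10¹²` (RH-free; spelled
out as a hypothesis on the tree's count `zetaZeroCountRe 0.9 T`, no named fact introduced) — and show that with it the ZERO SIDE of
the law STOPS BINDING: `RH(T) ∧ {Büthe 2016 Thm 2, Büthe 2018 Thm 2, BKLNW 2021} ∧ FKS-row ⟹ Robin at every CA number with primes
≤ X` for EVERY `X` in Büthe's `θ`-range `4.92·√(X/log X) ≤ T` (`T ≥ 3 000 175 332 800`).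

This part (RH-free, 0 `def`): D1 — from a count `N(0.9, t) ≤ 1300·√t` (`t ≥ 3·10¹²`) the two-sided density tail
`S(T) = Σ_{|γ|>T, β ≥ 0.9} m(ρ)/γ² ≤ (16/7)·2600/(T√T)` (blocks `(4ᵏT, 4ᵏ⁺¹T]`, reflection `ρ ↦ ρ̄`, `Real.tsum_le_of_sum_le`;
`N(σ,U)` as a real sum is the tree's `Literature.NumberTheory.LFunctions.natCast_zetaZeroCountRe`);
D2 — the FKS row implies `N(0.9, t) ≤ 1300·√t` for `t ≥ 3·10¹²` (`log t ≥ 28.5`).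

HONEST LABEL: SPLITTING SEARCH over kernel-typed RH-EQUIVALENCES; a splitting A ∧ B ⟹ RH is CONDITIONAL
bookkeeping unless A and B are both proved; nothing here bears on the truth of RH.
-/

set_option linter.dupNamespace false

noncomputable section

open Real Filter Finset
open scoped Chebyshev ComplexConjugate

namespace Summit.RiemannHypothesis.RiemannHypothesis.Theorems.Splittings.RobinFiniteC1

open Literature.NumberTheory.LFunctions Literature.NumberTheory.DiophantineGeometry
open Literature.NumberTheory.LFunctions.SchoenfeldBound
open Literature.NumberTheory.LFunctions.NicolasJExplicit
open RobinAnalyticSharp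
open Summit.RiemannHypothesis.RiemannHypothesis.Theorems.Splittings.RobinFiniteE3
open Summit.RiemannHypothesis.RiemannHypothesis.Theorems.Splittings.RobinFiniteTail
  (zeroTailBound_tailH tailH_PT_le tailH_nonneg)
open Summit.RiemannHypothesis.RiemannHypothesis.Theorems.Splittings.RobinFiniteE1c (summable_tailTerm)

section Density

/-! ### D1 · RH-free: the density tail `S(T) = Σ_{|γ|>T, β ≥ 0.9} m(ρ)/γ²` from a count `N(0.9, t) ≤ 1300·√t` -/

/-- One block: for `0 < T₁`, the zeros with `T₁ < Im ρ ≤ T₂` and `0.9 ≤ Re ρ` have `Σ m(ρ)/(Im ρ)² ≤ N(0.9, T₂)/T₁²`. -/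
theorem sum_block_le {T₁ T₂ : ℝ} (h1 : 0 < T₁) :
    ∑ ρ ∈ (zerosBetween T₁ T₂).filter (fun ρ => (0.9 : ℝ) ≤ ρ.re), (riemannZetaZeroOrder ρ : ℝ) / ρ.im ^ 2 ≤
      (zetaZeroCountRe 0.9 T₂ : ℝ) / T₁ ^ 2 := by
  classical
  have hsub : (zerosBetween T₁ T₂).filter (fun ρ => (0.9 : ℝ) ≤ ρ.re) ⊆ (zetaZeroBox_finite 0.9 T₂).toFinset := by
    intro ρ hρ
    rw [Finset.mem_filter] at hρ
    obtain ⟨hz, -, h2, h3, h4⟩ := (mem_zerosBetween h1.le).1 hρ.1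
    exact (Set.Finite.mem_toFinset _).2 ⟨hz, hρ.2, h2, h1.trans h3, h4⟩
  have hstep : ∀ ρ ∈ (zerosBetween T₁ T₂).filter (fun ρ => (0.9 : ℝ) ≤ ρ.re),
      (riemannZetaZeroOrder ρ : ℝ) / ρ.im ^ 2 ≤ (riemannZetaZeroOrder ρ : ℝ) / T₁ ^ 2 := by
    intro ρ hρ
    have hρ' := (Finset.mem_filter.1 hρ).1
    obtain ⟨-, -, -, h3, -⟩ := (mem_zerosBetween h1.le).1 hρ'
    exact div_le_div_of_nonneg_left (zeroOrder_nonneg_of_mem_zerosBetween h1.le hρ') (pow_pos h1 2)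
      (pow_le_pow_left₀ h1.le h3.le 2)
  calc ∑ ρ ∈ (zerosBetween T₁ T₂).filter (fun ρ => (0.9 : ℝ) ≤ ρ.re), (riemannZetaZeroOrder ρ : ℝ) / ρ.im ^ 2
      ≤ ∑ ρ ∈ (zerosBetween T₁ T₂).filter (fun ρ => (0.9 : ℝ) ≤ ρ.re), (riemannZetaZeroOrder ρ : ℝ) / T₁ ^ 2 :=
        Finset.sum_le_sum hstep
    _ ≤ ∑ ρ ∈ (zetaZeroBox_finite 0.9 T₂).toFinset, (riemannZetaZeroOrder ρ : ℝ) / T₁ ^ 2 :=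
        Finset.sum_le_sum_of_subset_of_nonneg hsub fun ρ hρ _ => by
          have h0 := riemannZetaZeroOrder_nonneg_of_mem_zetaZeroBox ((Set.Finite.mem_toFinset _).1 hρ)
          exact div_nonneg (by exact_mod_cast h0) (sq_nonneg _)
    _ = (zetaZeroCountRe 0.9 T₂ : ℝ) / T₁ ^ 2 := by
        rw [← Finset.sum_div, ← natCast_zetaZeroCountRe]

/-- The one-sided density sum on `(T, U]` is covered by the blocks `(4ᵏT, 4ᵏ⁺¹T]`, `k < K`, as soon as `U ≤ 4ᴷ·T`
(the blocks are pairwise disjoint). -/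
theorem sum_oneSided_blocks_le {T U : ℝ} (hT : 0 < T) (K : ℕ) (hU : U ≤ 4 ^ K * T) :
    ∑ ρ ∈ (zerosBetween T U).filter (fun ρ => (0.9 : ℝ) ≤ ρ.re), (riemannZetaZeroOrder ρ : ℝ) / ρ.im ^ 2 ≤
      ∑ k ∈ Finset.range K, (zetaZeroCountRe 0.9 (4 ^ (k + 1) * T) : ℝ) / (4 ^ k * T) ^ 2 := by
  classical
  have hcover : (zerosBetween T U).filter (fun ρ => (0.9 : ℝ) ≤ ρ.re) ⊆
      (Finset.range K).biUnion
        (fun k => (zerosBetween (4 ^ k * T) (4 ^ (k + 1) * T)).filter (fun ρ => (0.9 : ℝ) ≤ ρ.re)) := by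
    intro ρ hρ
    rw [Finset.mem_filter] at hρ
    obtain ⟨hz, h1, h2, h3, h4⟩ := (mem_zerosBetween hT.le).1 hρ.1
    have hK0 : K ≠ 0 := by
      rintro rfl
      simp only [pow_zero, one_mul] at hU
      linarith
    have hex : ∃ k : ℕ, ρ.im ≤ 4 ^ (k + 1) * T :=
      ⟨K - 1, by rw [Nat.sub_add_cancel (Nat.pos_of_ne_zero hK0)]; exact h4.trans hU⟩
    set k₀ := Nat.find hex with hk₀
    have hspec : ρ.im ≤ 4 ^ (k₀ + 1) * T := Nat.find_spec hex
    have hlow : 4 ^ k₀ * T < ρ.im := by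
      rcases Nat.eq_zero_or_pos k₀ with h0 | hpos
      · rw [h0, pow_zero, one_mul]; exact h3
      · have hmin := Nat.find_min hex (m := k₀ - 1) (by omega)
        rw [not_le, Nat.sub_add_cancel hpos] at hmin
        exact hmin
    have hkK : k₀ < K := by
      have := Nat.find_le (h := hex) (n := K - 1)
        (by rw [Nat.sub_add_cancel (Nat.pos_of_ne_zero hK0)]; exact h4.trans hU)
      omega
    rw [Finset.mem_biUnion]
    refine ⟨k₀, Finset.mem_range.2 hkK, Finset.mem_filter.2 ⟨(mem_zerosBetween (by positivity)).2
      ⟨hz, h1, h2, hlow, hspec⟩, hρ.2⟩⟩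
  have hdisj : Set.PairwiseDisjoint (↑(Finset.range K) : Set ℕ)
      (fun k => (zerosBetween (4 ^ k * T) (4 ^ (k + 1) * T)).filter (fun ρ => (0.9 : ℝ) ≤ ρ.re)) := by
    intro i _ j _ hij
    rw [Function.onFun, Finset.disjoint_left]
    intro ρ hi hj
    have hi' := (Finset.mem_filter.1 hi).1
    have hj' := (Finset.mem_filter.1 hj).1
    obtain ⟨-, -, -, hi3, hi4⟩ := (mem_zerosBetween (by positivity)).1 hi'
    obtain ⟨-, -, -, hj3, hj4⟩ := (mem_zerosBetween (by positivity)).1 hj'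
    rcases lt_or_gt_of_ne hij with h | h
    · have : (4 : ℝ) ^ (i + 1) * T ≤ 4 ^ j * T :=
        mul_le_mul_of_nonneg_right (pow_le_pow_right₀ (by norm_num) (by omega)) hT.le
      linarith
    · have : (4 : ℝ) ^ (j + 1) * T ≤ 4 ^ i * T :=
        mul_le_mul_of_nonneg_right (pow_le_pow_right₀ (by norm_num) (by omega)) hT.le
      linarith
  calc ∑ ρ ∈ (zerosBetween T U).filter (fun ρ => (0.9 : ℝ) ≤ ρ.re), (riemannZetaZeroOrder ρ : ℝ) / ρ.im ^ 2
      ≤ ∑ ρ ∈ (Finset.range K).biUnion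
          (fun k => (zerosBetween (4 ^ k * T) (4 ^ (k + 1) * T)).filter (fun ρ => (0.9 : ℝ) ≤ ρ.re)),
            (riemannZetaZeroOrder ρ : ℝ) / ρ.im ^ 2 := by
        refine Finset.sum_le_sum_of_subset_of_nonneg hcover fun ρ hρ _ => ?_
        obtain ⟨k, -, hk⟩ := Finset.mem_biUnion.1 hρ
        exact div_nonneg (zeroOrder_nonneg_of_mem_zerosBetween (by positivity) (Finset.mem_filter.1 hk).1) (sq_nonneg _)
    _ = ∑ k ∈ Finset.range K, ∑ ρ ∈ (zerosBetween (4 ^ k * T) (4 ^ (k + 1) * T)).filter (fun ρ => (0.9 : ℝ) ≤ ρ.re),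
            (riemannZetaZeroOrder ρ : ℝ) / ρ.im ^ 2 := Finset.sum_biUnion hdisj
    _ ≤ ∑ k ∈ Finset.range K, (zetaZeroCountRe 0.9 (4 ^ (k + 1) * T) : ℝ) / (4 ^ k * T) ^ 2 :=
        Finset.sum_le_sum fun k _ => sum_block_le (by positivity)

/-- **One-sided density tail from the count `N(0.9, t) ≤ 1300·√t` (`t ≥ 3·10¹²`)**: for `T ≥ 3·10¹²` and every `U`,
`Σ_{T < γ ≤ U, β ≥ 0.9} m/γ² ≤ (8/7)·2600/(T√T)` (block `k`: `N(0.9, 4ᵏ⁺¹T)/(4ᵏT)² ≤ 2600/(T√T)·8⁻ᵏ`; geometric sum). -/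
theorem sum_oneSided_dens_le {T U : ℝ} (hT : 3 * (10 : ℝ) ^ 12 ≤ T)
    (hN : ∀ t : ℝ, 3 * (10 : ℝ) ^ 12 ≤ t → (zetaZeroCountRe 0.9 t : ℝ) ≤ 1300 * √t) :
    ∑ ρ ∈ (zerosBetween T U).filter (fun ρ => (0.9 : ℝ) ≤ ρ.re), (riemannZetaZeroOrder ρ : ℝ) / ρ.im ^ 2 ≤
      8 / 7 * (2600 / (T * √T)) := by
  have hT0 : 0 < T := lt_of_lt_of_le (by norm_num) hT
  have hs0 : 0 < √T := Real.sqrt_pos.2 hT0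
  obtain ⟨K, hK⟩ : ∃ K : ℕ, U ≤ 4 ^ K * T := by
    obtain ⟨K, hK⟩ := pow_unbounded_of_one_lt (U / T) (by norm_num : (1 : ℝ) < 4)
    exact ⟨K, by rw [div_lt_iff₀ hT0] at hK; exact hK.le⟩
  refine (sum_oneSided_blocks_le hT0 K hK).trans ?_
  have hterm : ∀ k ∈ Finset.range K,
      (zetaZeroCountRe 0.9 (4 ^ (k + 1) * T) : ℝ) / (4 ^ k * T) ^ 2 ≤ 2600 / (T * √T) * (1 / 8) ^ k := by
    intro k _
    have h4T : 3 * (10 : ℝ) ^ 12 ≤ 4 ^ (k + 1) * T :=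
      le_trans hT (le_mul_of_one_le_left hT0.le (one_le_pow₀ (by norm_num)))
    have hsq : √(4 ^ (k + 1) * T) = 2 ^ (k + 1) * √T := by
      rw [Real.sqrt_mul' _ hT0.le, show (4 : ℝ) ^ (k + 1) = (2 ^ (k + 1)) ^ 2 by rw [← pow_mul, mul_comm, pow_mul]; norm_num,
        Real.sqrt_sq (by positivity)]
    have hNk : (zetaZeroCountRe 0.9 (4 ^ (k + 1) * T) : ℝ) ≤ 1300 * (2 ^ (k + 1) * √T) := by
      rw [← hsq]; exact hN _ h4T
    have h4k : (4 : ℝ) ^ k = (2 ^ k) ^ 2 := by rw [← pow_mul, mul_comm, pow_mul]; norm_num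
    have h8k : ((1 : ℝ) / 8) ^ k = 1 / (2 ^ k) ^ 3 := by rw [div_pow, one_pow, ← pow_mul, mul_comm, pow_mul]; norm_num
    have hss : √T * √T = T := Real.mul_self_sqrt hT0.le
    have h2k : (0 : ℝ) < 2 ^ k := by positivity
    calc (zetaZeroCountRe 0.9 (4 ^ (k + 1) * T) : ℝ) / (4 ^ k * T) ^ 2
        ≤ 1300 * (2 ^ (k + 1) * √T) / (4 ^ k * T) ^ 2 := div_le_div_of_nonneg_right hNk (by positivity)
      _ = 2600 / (T * √T) * (1 / 8) ^ k := by
          rw [h4k, h8k, pow_succ]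
          have key : ∀ s : ℝ, 0 < s →
              1300 * (2 ^ k * 2 * s) / (((2 : ℝ) ^ k) ^ 2 * (s * s)) ^ 2 = 2600 / (s * s * s) * (1 / ((2 : ℝ) ^ k) ^ 3) := by
            intro s hs
            field_simp
            ring
          have := key (√T) hs0
          rwa [hss] at this
  have hgeom : ∑ k ∈ Finset.range K, ((1 : ℝ) / 8) ^ k ≤ 8 / 7 := by
    have h := geom_sum_Ico_le_of_lt_one (m := 0) (n := K) (x := (1 : ℝ) / 8) (by norm_num) (by norm_num)
    rw [← Finset.range_eq_Ico] at h
    refine h.trans ?_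
    norm_num
  calc ∑ k ∈ Finset.range K, (zetaZeroCountRe 0.9 (4 ^ (k + 1) * T) : ℝ) / (4 ^ k * T) ^ 2
      ≤ ∑ k ∈ Finset.range K, 2600 / (T * √T) * (1 / 8) ^ k := Finset.sum_le_sum hterm
    _ = 2600 / (T * √T) * ∑ k ∈ Finset.range K, ((1 : ℝ) / 8) ^ k := by rw [Finset.mul_sum]
    _ ≤ 2600 / (T * √T) * (8 / 7) := mul_le_mul_of_nonneg_left hgeom (by positivity)
    _ = 8 / 7 * (2600 / (T * √T)) := by ring

/-- Every finite partial sum of the two-sided density tail series is `≤ (16/7)·2600/(T√T)` (`T ≥ 3·10¹²`): reflection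
`ρ ↦ ρ̄` (`m(ρ̄) = m(ρ)`, `Re ρ̄ = Re ρ`, `(Im ρ̄)² = (Im ρ)²`; `sum_sdiff_zerosUpTo_eq_two_mul`) + the one-sided bound above the set. -/
theorem sum_densTerm_le {T : ℝ} (hT : 3 * (10 : ℝ) ^ 12 ≤ T)
    (hN : ∀ t : ℝ, 3 * (10 : ℝ) ^ 12 ≤ t → (zetaZeroCountRe 0.9 t : ℝ) ≤ 1300 * √t)
    (s : Finset RHWave0.riemannZetaNontrivialZeros) :
    ∑ ρ ∈ s, (if T < |(ρ : ℂ).im| ∧ (0.9 : ℝ) ≤ (ρ : ℂ).re then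
        (riemannZetaZeroOrder (ρ : ℂ) : ℝ) / (ρ : ℂ).im ^ 2 else 0) ≤ 16 / 7 * (2600 / (T * √T)) := by
  classical
  have h0 : (0 : ℝ) ≤ T := le_trans (by norm_num) hT
  set U : ℝ := T + ∑ ρ ∈ s, |(ρ : ℂ).im| with hU
  have hle : ∀ ρ ∈ s, |(ρ : ℂ).im| ≤ U := fun ρ hρ => by
    rw [hU]
    have := Finset.single_le_sum (fun ρ' (_ : ρ' ∈ s) => abs_nonneg ((ρ' : ℂ).im)) hρ
    linarith
  have h1 : ∑ ρ ∈ s.filter (fun ρ : RHWave0.riemannZetaNontrivialZeros => T < |(ρ : ℂ).im| ∧ (0.9 : ℝ) ≤ (ρ : ℂ).re),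
        (riemannZetaZeroOrder (ρ : ℂ) : ℝ) / (ρ : ℂ).im ^ 2 ≤
      ∑ ρ ∈ (zerosUpTo U \ zerosUpTo T).filter (fun ρ : RHWave0.riemannZetaNontrivialZeros => (0.9 : ℝ) ≤ (ρ : ℂ).re),
        (riemannZetaZeroOrder (ρ : ℂ) : ℝ) / (ρ : ℂ).im ^ 2 := by
    refine Finset.sum_le_sum_of_subset_of_nonneg (fun ρ hρ => ?_) fun ρ _ _ =>
      div_nonneg (zeroOrder_nonneg' ρ) (sq_nonneg _)
    rw [Finset.mem_filter] at hρ ⊢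
    rw [Finset.mem_sdiff, mem_zerosUpTo, mem_zerosUpTo, not_le]
    exact ⟨⟨hle ρ hρ.1, hρ.2.1⟩, hρ.2.2⟩
  have h2 := sum_sdiff_zerosUpTo_eq_two_mul h0 (T₂ := U)
    (g := fun z => if (0.9 : ℝ) ≤ z.re then (riemannZetaZeroOrder z : ℝ) / z.im ^ 2 else 0)
    (fun z => by simp only [riemannZetaZeroOrder_conj_holds z, Complex.conj_re, Complex.conj_im, neg_sq])
  have h3 : ∑ ρ ∈ (zerosBetween T U).filter (fun ρ => (0.9 : ℝ) ≤ ρ.re), (riemannZetaZeroOrder ρ : ℝ) / ρ.im ^ 2 ≤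
      8 / 7 * (2600 / (T * √T)) := sum_oneSided_dens_le hT hN
  calc ∑ ρ ∈ s, (if T < |(ρ : ℂ).im| ∧ (0.9 : ℝ) ≤ (ρ : ℂ).re then
          (riemannZetaZeroOrder (ρ : ℂ) : ℝ) / (ρ : ℂ).im ^ 2 else 0)
      = ∑ ρ ∈ s.filter (fun ρ : RHWave0.riemannZetaNontrivialZeros => T < |(ρ : ℂ).im| ∧ (0.9 : ℝ) ≤ (ρ : ℂ).re),
          (riemannZetaZeroOrder (ρ : ℂ) : ℝ) / (ρ : ℂ).im ^ 2 := (Finset.sum_filter _ _).symm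
    _ ≤ ∑ ρ ∈ (zerosUpTo U \ zerosUpTo T).filter (fun ρ : RHWave0.riemannZetaNontrivialZeros => (0.9 : ℝ) ≤ (ρ : ℂ).re),
          (riemannZetaZeroOrder (ρ : ℂ) : ℝ) / (ρ : ℂ).im ^ 2 := h1
    _ = ∑ ρ ∈ zerosUpTo U \ zerosUpTo T,
          (if (0.9 : ℝ) ≤ (ρ : ℂ).re then (riemannZetaZeroOrder (ρ : ℂ) : ℝ) / (ρ : ℂ).im ^ 2 else 0) :=
        Finset.sum_filter _ _
    _ = 2 * ∑ ρ ∈ zerosBetween T U, (if (0.9 : ℝ) ≤ ρ.re then (riemannZetaZeroOrder ρ : ℝ) / ρ.im ^ 2 else 0) := h2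
    _ = 2 * ∑ ρ ∈ (zerosBetween T U).filter (fun ρ => (0.9 : ℝ) ≤ ρ.re), (riemannZetaZeroOrder ρ : ℝ) / ρ.im ^ 2 := by
        rw [Finset.sum_filter]
    _ ≤ 2 * (8 / 7 * (2600 / (T * √T))) := mul_le_mul_of_nonneg_left h3 (by norm_num)
    _ = 16 / 7 * (2600 / (T * √T)) := by ring

/-- **The density tail `S(T) = Σ_{|γ|>T, β ≥ 0.9} m(ρ)/γ² ≤ (16/7)·2600/(T√T)`** for `T ≥ 3·10¹²`, from `N(0.9, t) ≤ 1300√t`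
(`t ≥ 3·10¹²`) — the sum over ALL non-trivial zeros with multiplicity (`Real.tsum_le_of_sum_le`). RH-free. -/
theorem densTail_le {T : ℝ} (hT : 3 * (10 : ℝ) ^ 12 ≤ T)
    (hN : ∀ t : ℝ, 3 * (10 : ℝ) ^ 12 ≤ t → (zetaZeroCountRe 0.9 t : ℝ) ≤ 1300 * √t) :
    ∑' ρ : RHWave0.riemannZetaNontrivialZeros,
        (if T < |(ρ : ℂ).im| ∧ (0.9 : ℝ) ≤ (ρ : ℂ).re then
          (riemannZetaZeroOrder (ρ : ℂ) : ℝ) / (ρ : ℂ).im ^ 2 else 0) ≤ 16 / 7 * (2600 / (T * √T)) := by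
  have hnn : 0 ≤ fun ρ : RHWave0.riemannZetaNontrivialZeros =>
      (if T < |(ρ : ℂ).im| ∧ (0.9 : ℝ) ≤ (ρ : ℂ).re then
        (riemannZetaZeroOrder (ρ : ℂ) : ℝ) / (ρ : ℂ).im ^ 2 else 0) := by
    intro ρ
    simp only [Pi.zero_apply]
    split_ifs
    · exact div_nonneg (zeroOrder_nonneg' ρ) (sq_nonneg _)
    · exact le_rfl
  exact Real.tsum_le_of_sum_le hnn fun s => sum_densTerm_le hT hN s

/-! ### D2 · the explicit density row (FKS 2023 Cor. 2.9, `σ ∈ [0.9, 1]`) implies `N(0.9, t) ≤ 1300·√t` for `t ≥ 3·10¹²` -/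

/-- `exp 28.5 ≤ 3·10¹²` (`e ≤ 2.7182818286`; `exp 0.5 ≤ 1.6488` by `Real.exp_bound'`, five terms). -/
theorem exp_285_le : Real.exp 28.5 ≤ 3 * (10 : ℝ) ^ 12 := by
  have h1 : Real.exp 28.5 = Real.exp 1 ^ 28 * Real.exp 0.5 := by
    rw [Real.exp_one_pow, ← Real.exp_add]; congr 1; norm_num
  have h2 : Real.exp 1 ^ 28 ≤ (2.7182818286 : ℝ) ^ 28 :=
    pow_le_pow_left₀ (Real.exp_pos 1).le Real.exp_one_lt_d9.le 28
  have h3 : Real.exp 0.5 ≤ 1.6488 := by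
    have h := Real.exp_bound' (x := (0.5 : ℝ)) (by norm_num) (by norm_num) (n := 5) (by norm_num)
    refine h.trans ?_
    simp only [Finset.sum_range_succ, Finset.sum_range_zero, Nat.factorial]
    norm_num
  rw [h1]
  calc Real.exp 1 ^ 28 * Real.exp 0.5 ≤ (2.7182818286 : ℝ) ^ 28 * 1.6488 :=
        mul_le_mul h2 h3 (Real.exp_pos _).le (by positivity)
    _ ≤ 3 * (10 : ℝ) ^ 12 := by norm_num

/-- `28.5^{16/5} ≤ 45500` (`28.5¹⁶ ≤ 45500⁵`). -/
theorem rpow_285_le : (28.5 : ℝ) ^ (16 / 5 : ℝ) ≤ 45500 := by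
  have e : (16 / 5 : ℝ) = ((16 : ℕ) : ℝ) * (((5 : ℕ) : ℝ)⁻¹) := by norm_num
  rw [e, Real.rpow_mul (by norm_num), Real.rpow_natCast]
  calc (((28.5 : ℝ) ^ (16 : ℕ)) ^ (((5 : ℕ) : ℝ)⁻¹) : ℝ) ≤ ((45500 : ℝ) ^ (5 : ℕ)) ^ (((5 : ℕ) : ℝ)⁻¹) :=
        Real.rpow_le_rpow (by positivity) (by norm_num) (by positivity)
    _ = 45500 := Real.pow_rpow_inv_natCast (by norm_num) (by norm_num)

/-- `750 ≤ exp 6.65` (`e ≥ 2.7182818283`, `exp 0.65 ≥ 1 + 0.65 + 0.65²/2`). -/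
theorem exp_665_ge : (750 : ℝ) ≤ Real.exp 6.65 := by
  have h1 : Real.exp 6.65 = Real.exp 1 ^ 6 * Real.exp 0.65 := by
    rw [Real.exp_one_pow, ← Real.exp_add]; congr 1; norm_num
  have h2 : (2.7182818283 : ℝ) ^ 6 ≤ Real.exp 1 ^ 6 := pow_le_pow_left₀ (by norm_num) Real.exp_one_gt_d9.le 6
  have h3 : (1 + 0.65 + 0.65 ^ 2 / 2 : ℝ) ≤ Real.exp 0.65 := Real.quadratic_le_exp_of_nonneg (by norm_num)
  rw [h1]
  calc (750 : ℝ) ≤ 2.7182818283 ^ 6 * (1 + 0.65 + 0.65 ^ 2 / 2) := by norm_num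
    _ ≤ Real.exp 1 ^ 6 * Real.exp 0.65 := mul_le_mul h2 h3 (by norm_num) (by positivity)

/-- **FKS 2023 Cor. 2.9 (row `σ ∈ [0.9, 1]`: `c₁ = 17.4194`, `c₂ = 2.9089`, `p = 4/15`, `q = 16/5` at `σ = 0.9`; `T ≥ 3·10¹²`)
implies `N(0.9, t) ≤ 1300·√t` for `t ≥ 3·10¹²`.**  With `u = log t ≥ 28.5`: `u² ≤ u^{16/5}`, `log u ≤ log 28.5 + u/28.5 − 1`,
so `t^{4/15}u^{16/5} ≤ 28.5^{16/5}·exp(u/2)·exp(−0.121u − 3.2) ≤ (45500/750)√t`; `20.3283·45500/750 = 1233.3 ≤ 1300`. -/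
theorem count09_le_of_densityRow
    (hZD : ∀ t : ℝ, 3 * (10 : ℝ) ^ 12 ≤ t →
      (zetaZeroCountRe 0.9 t : ℝ) ≤ 17.4194 * t ^ (4 / 15 : ℝ) * Real.log t ^ (16 / 5 : ℝ) + 2.9089 * Real.log t ^ 2) :
    ∀ t : ℝ, 3 * (10 : ℝ) ^ 12 ≤ t → (zetaZeroCountRe 0.9 t : ℝ) ≤ 1300 * √t := by
  intro t ht
  have ht0 : 0 < t := lt_of_lt_of_le (by norm_num) ht
  have hrow := hZD t ht
  obtain ⟨u, hu⟩ : ∃ u : ℝ, Real.log t = u := ⟨_, rfl⟩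
  rw [hu] at hrow
  have hu285 : 28.5 ≤ u := by
    rw [← hu, Real.le_log_iff_exp_le ht0]; exact exp_285_le.trans ht
  have hu0 : 0 < u := by linarith
  have hu1 : 1 ≤ u := by linarith
  have e1 : t ^ (4 / 15 : ℝ) = Real.exp (4 / 15 * u) := by
    rw [Real.rpow_def_of_pos ht0, hu]; ring_nf
  have e2 : √t = Real.exp (u / 2) := by
    rw [Real.sqrt_eq_rpow, Real.rpow_def_of_pos ht0, hu]; ring_nf
  have e3 : u ^ (16 / 5 : ℝ) = Real.exp (16 / 5 * Real.log u) := by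
    rw [Real.rpow_def_of_pos hu0]; ring_nf
  -- (`linarith` cannot digest `u / 28.5`; the ratio is written `2u/57`)
  have hlogu : Real.log u ≤ Real.log 28.5 + (2 * u / 57 - 1) := by
    have h := Real.log_le_sub_one_of_pos (show 0 < u / 28.5 by positivity)
    rw [Real.log_div hu0.ne' (by norm_num)] at h
    have e : u / 28.5 = 2 * u / 57 := by norm_num; ring
    rw [e] at h
    linarith
  have h285 : Real.exp (16 / 5 * Real.log 28.5) ≤ 45500 := by
    have : Real.exp (16 / 5 * Real.log 28.5) = (28.5 : ℝ) ^ (16 / 5 : ℝ) := by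
      rw [Real.rpow_def_of_pos (by norm_num : (0 : ℝ) < 28.5)]; ring_nf
    rw [this]; exact rpow_285_le
  have hu2 : u ^ 2 ≤ u ^ (16 / 5 : ℝ) := by
    rw [show u ^ 2 = u ^ (2 : ℝ) by rw [← Real.rpow_natCast]; norm_num]
    exact Real.rpow_le_rpow_of_exponent_le hu1 (by norm_num)
  have hmain : t ^ (4 / 15 : ℝ) * u ^ (16 / 5 : ℝ) ≤ 45500 / 750 * √t := by
    rw [e1, e2, e3]
    have h4 : Real.exp (16 / 5 * Real.log u) ≤ 45500 * Real.exp (16 / 5 * (2 * u / 57 - 1)) := by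
      calc Real.exp (16 / 5 * Real.log u) ≤ Real.exp (16 / 5 * (Real.log 28.5 + (2 * u / 57 - 1))) :=
            Real.exp_le_exp.2 (by linarith)
        _ = Real.exp (16 / 5 * Real.log 28.5) * Real.exp (16 / 5 * (2 * u / 57 - 1)) := by
            rw [← Real.exp_add]; ring_nf
        _ ≤ 45500 * Real.exp (16 / 5 * (2 * u / 57 - 1)) :=
            mul_le_mul_of_nonneg_right h285 (Real.exp_pos _).le
    have h5 : Real.exp (4 / 15 * u) * Real.exp (16 / 5 * (2 * u / 57 - 1)) ≤ Real.exp (u / 2) / 750 := by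
      rw [← Real.exp_add]
      have hexp : 4 / 15 * u + 16 / 5 * (2 * u / 57 - 1) ≤ u / 2 + (-6.65) := by linarith
      have hinv : Real.exp (-6.65) ≤ 1 / 750 := by
        rw [Real.exp_neg, one_div]
        exact inv_anti₀ (by norm_num) exp_665_ge
      calc Real.exp (4 / 15 * u + 16 / 5 * (2 * u / 57 - 1)) ≤ Real.exp (u / 2 + (-6.65)) := Real.exp_le_exp.2 hexp
        _ = Real.exp (u / 2) * Real.exp (-6.65) := Real.exp_add _ _
        _ ≤ Real.exp (u / 2) * (1 / 750) := mul_le_mul_of_nonneg_left hinv (Real.exp_pos _).le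
        _ = Real.exp (u / 2) / 750 := by ring
    calc Real.exp (4 / 15 * u) * Real.exp (16 / 5 * Real.log u)
        ≤ Real.exp (4 / 15 * u) * (45500 * Real.exp (16 / 5 * (2 * u / 57 - 1))) :=
          mul_le_mul_of_nonneg_left h4 (Real.exp_pos _).le
      _ = 45500 * (Real.exp (4 / 15 * u) * Real.exp (16 / 5 * (2 * u / 57 - 1))) := by ring
      _ ≤ 45500 * (Real.exp (u / 2) / 750) := mul_le_mul_of_nonneg_left h5 (by norm_num)
      _ = 45500 / 750 * Real.exp (u / 2) := by ring
  have ht415 : 1 ≤ t ^ (4 / 15 : ℝ) := Real.one_le_rpow (by linarith) (by norm_num)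
  have hprod0 : 0 ≤ t ^ (4 / 15 : ℝ) * u ^ (16 / 5 : ℝ) := by positivity
  have hu2' : u ^ 2 ≤ t ^ (4 / 15 : ℝ) * u ^ (16 / 5 : ℝ) :=
    hu2.trans (le_mul_of_one_le_left (Real.rpow_nonneg hu0.le _) ht415)
  have hs0 : 0 ≤ √t := Real.sqrt_nonneg t
  calc (zetaZeroCountRe 0.9 t : ℝ) ≤ 17.4194 * t ^ (4 / 15 : ℝ) * u ^ (16 / 5 : ℝ) + 2.9089 * u ^ 2 := hrow
    _ ≤ 20.3283 * (t ^ (4 / 15 : ℝ) * u ^ (16 / 5 : ℝ)) := by nlinarith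
    _ ≤ 20.3283 * (45500 / 750 * √t) := mul_le_mul_of_nonneg_left hmain (by norm_num)
    _ ≤ 1300 * √t := by nlinarith

end Density

end Summit.RiemannHypothesis.RiemannHypothesis.Theorems.Splittings.RobinFiniteC1

end
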